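import Summits.QuantumFields.GaugeBoot.DiagonalRPTorusPolyakovCover
import Summits.QuantumFields.GaugeBoot.DiagonalRPTorusPolyakovLadderValue
import HarnessLib

/-!
# Cluster terms of the small-`β` expansion of a Polyakov-loop correlator (gauge-boot, task L3(ξ))

HONEST FRAMING (cell `pub-gaugeboot`, page 1 of every file): the venture produces certified bounds
on lattice expectations at stated coupling, gauge group, dimension and torus size; NOT a mass gap,
NOT a continuum limit, NOT a string tension; NOT Yang–Mills-summit-bearing (barriers
`FixedCouplingUltralocality`, `PerturbativeInvisibility`). This module is analytic bookkeeping
for the structural NEGATIVE result `DiagonalRPTorusNegativeOddSUN` (closed-half diagonal RP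
fails on odd three-tori for `G ≅ SU(N)` at small coupling); it discharges nothing by itself.

## Content (torus `(ℤ/L)³`, any compact metrisable `G`, continuous `ρ`, `β ≥ 0`)

Write `e^{β Re tr ρ(U_p)} = 1 + g_p(U)` and expand `∏_p (1 + g_p) = Σ_{S ⊆ plaquettes} ∏_{p∈S} g_p`.
The PAIR TERMS `T_S(A,B) = ∫ P_A P_B ∏_{p ∈ S} g_p ∏ dU` (`pairTerm`) of two Polyakov loops satisfy:
* `abs_pairTerm_le` — `|T_S(A,B)| ≤ N² (2βN)^{|S|}` for `βN ≤ 1`;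
* `pairTerm_eq_zero_of_not_covers_right/left` — `T_S(A,B) = 0` unless `S` covers both columns
  (centre twist, `DiagRPSUN.integral_polRe_mul_polRe_mul_prod_eq_zero`), given `ρ z₀ = ω • 1`,
  `ω ≠ 1`;
* `abs_pairTerm_le_of_apart` — columns differing in both coordinates: `|T_S(A,B)| ≤ N² γ^{L+1}`
  for EVERY `S` (`γ = 2βN ≤ 1`), since a non-zero term needs `|S| ≥ 2L`;
* `abs_pairTerm_le_of_adjacent` — adjacent columns, `S ≠` the rung ladder: `|T_S(A,B)| ≤ N² γ^{L+1}`;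
* `abs_pairTerm_ladder_sub_le` — the ladder term is `β^L I(A,B)` up to `N² 2^L (βN)^{L+1}`
  (`I(A,B) = DiagRPSUN.ladderIntegral`, second-order Taylor remainder of `exp` per rung).

Elementary; no named fact.
-/

open MeasureTheory Complex Finset Function
open scoped ComplexOrder

namespace Summit.QuantumFields.GaugeBoot

open Literature.MathematicalPhysics.QuantumFieldTheory
open Literature.MathematicalPhysics.QuantumFieldTheory.PlaquetteLowerBound (reTr)
open Literature.RepresentationTheory.CompactGroups

noncomputable section

namespace DiagRPSUN

open DiagRPThree DiagRPPolyakov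

/-! ## A product perturbation bound -/

section ProdBound

/-- **Perturbing a product**: if `|a_i| ≤ t ≤ 1` and `|b_i| ≤ t²` on a finite set of size `n`,
then `|∏ (a_i + b_i) - ∏ a_i| ≤ 2^n t^{n+1}`. -/
theorem abs_prod_add_sub_prod_le {ι : Type*} [DecidableEq ι] (s : Finset ι) (a b : ι → ℝ) {t : ℝ}
    (ht0 : 0 ≤ t) (ht1 : t ≤ 1) (ha : ∀ i ∈ s, |a i| ≤ t) (hb : ∀ i ∈ s, |b i| ≤ t ^ 2) :
    |∏ i ∈ s, (a i + b i) - ∏ i ∈ s, a i| ≤ 2 ^ s.card * t ^ (s.card + 1) := by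
  have hexp : ∏ i ∈ s, (a i + b i) = ∑ T ∈ s.powerset, (∏ i ∈ T, b i) * ∏ i ∈ s \ T, a i := by
    rw [show (fun i => a i + b i) = fun i => b i + a i from funext fun i => add_comm _ _]
    exact prod_add _ _ _
  have hempty : (∏ i ∈ (∅ : Finset ι), b i) * ∏ i ∈ s \ ∅, a i = ∏ i ∈ s, a i := by simp
  rw [hexp, ← hempty, ← sum_erase_add _ _ (empty_mem_powerset s), add_sub_cancel_right]
  have hterm : ∀ T ∈ (s.powerset).erase ∅, |(∏ i ∈ T, b i) * ∏ i ∈ s \ T, a i| ≤ t ^ (s.card + 1) := by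
    intro T hT
    obtain ⟨hTne, hTs⟩ := mem_erase.1 hT
    rw [mem_powerset] at hTs
    have hTcard : 1 ≤ T.card := card_pos.2 (nonempty_iff_ne_empty.2 hTne)
    rw [abs_mul, abs_prod, abs_prod]
    calc (∏ i ∈ T, |b i|) * ∏ i ∈ s \ T, |a i|
        ≤ (∏ _i ∈ T, t ^ 2) * ∏ _i ∈ s \ T, t :=
          mul_le_mul (prod_le_prod (fun i _ => abs_nonneg _) fun i hi => hb i (hTs hi))
            (prod_le_prod (fun i _ => abs_nonneg _) fun i hi => ha i (sdiff_subset hi))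
            (prod_nonneg fun i _ => abs_nonneg _) (prod_nonneg fun i _ => by positivity)
      _ = t ^ (s.card + T.card) := by
          rw [prod_const, prod_const, ← pow_mul, ← pow_add, card_sdiff_of_subset hTs]
          congr 1
          have := card_le_card hTs
          omega
      _ ≤ t ^ (s.card + 1) := pow_le_pow_of_le_one ht0 ht1 (by omega)
  calc |∑ T ∈ (s.powerset).erase ∅, (∏ i ∈ T, b i) * ∏ i ∈ s \ T, a i|
      ≤ ∑ T ∈ (s.powerset).erase ∅, |(∏ i ∈ T, b i) * ∏ i ∈ s \ T, a i| := abs_sum_le_sum_abs _ _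
    _ ≤ ∑ _T ∈ (s.powerset).erase ∅, t ^ (s.card + 1) := sum_le_sum hterm
    _ ≤ 2 ^ s.card * t ^ (s.card + 1) := by
        rw [sum_const, nsmul_eq_mul]
        refine mul_le_mul_of_nonneg_right ?_ (by positivity)
        have h := card_le_card (erase_subset ∅ s.powerset)
        rw [card_powerset] at h
        exact_mod_cast h

end ProdBound

/-! ## Pair terms -/

section Pair

variable {L : ℕ} [NeZero L] {N : ℕ} {G : Type*} [Group G] [TopologicalSpace G]
  [IsTopologicalGroup G] [CompactSpace G] [MeasurableSpace G] [BorelSpace G]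
  [SecondCountableTopology G] (ρ : G →* Matrix (Fin N) (Fin N) ℂ) (β : ℝ)

/-- The plaquette factor `g_p(U) = e^{β Re tr ρ(U_p)} - 1` of the small-`β` expansion. -/
def gfac (p : Plaquette 3 L) (U : GaugeConfig 3 L G) : ℝ :=
  Real.exp (β * WilsonRP.plaqRe ρ U p) - 1

/-- The PAIR TERM `T_S(A,B) = ∫ P_A P_B ∏_{p ∈ S} g_p ∏ dU` of two Polyakov loops. -/
def pairTerm (S : Finset (Plaquette 3 L)) (A B : ZMod L × ZMod L) : ℝ :=
  ∫ U, polRe ρ 2 U (vsite A 0) * polRe ρ 2 U (vsite B 0) * ∏ p ∈ S, gfac ρ β p U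
    ∂Measure.pi fun _ : Edge 3 L => haarProbability G

omit [NeZero L] [MeasurableSpace G] [BorelSpace G] [SecondCountableTopology G] in
/-- `|g_p| ≤ 2βN` for `0 ≤ β`, `βN ≤ 1`. -/
theorem abs_gfac_le (hρ : Continuous ρ) (hβ : 0 ≤ β) (hβN : β * N ≤ 1) (p : Plaquette 3 L)
    (U : GaugeConfig 3 L G) : |gfac ρ β p U| ≤ 2 * β * N := by
  have hx : |β * WilsonRP.plaqRe ρ U p| ≤ β * N := by
    rw [abs_mul, abs_of_nonneg hβ]
    exact mul_le_mul_of_nonneg_left (WilsonRP.abs_plaqRe_le ρ hρ U p) hβ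
  unfold gfac
  calc |Real.exp (β * WilsonRP.plaqRe ρ U p) - 1| ≤ 2 * |β * WilsonRP.plaqRe ρ U p| :=
        Real.abs_exp_sub_one_le (hx.trans hβN)
    _ ≤ 2 * (β * N) := by linarith
    _ = 2 * β * N := by ring

omit [NeZero L] [MeasurableSpace G] [BorelSpace G] [SecondCountableTopology G] in
/-- `|g_p - β Re tr ρ(U_p)| ≤ (βN)²` for `0 ≤ β`, `βN ≤ 1` (second-order Taylor remainder). -/
theorem abs_gfac_sub_le (hρ : Continuous ρ) (hβ : 0 ≤ β) (hβN : β * N ≤ 1) (p : Plaquette 3 L)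
    (U : GaugeConfig 3 L G) :
    |gfac ρ β p U - β * WilsonRP.plaqRe ρ U p| ≤ (β * N) ^ 2 := by
  have hx : |β * WilsonRP.plaqRe ρ U p| ≤ β * N := by
    rw [abs_mul, abs_of_nonneg hβ]
    exact mul_le_mul_of_nonneg_left (WilsonRP.abs_plaqRe_le ρ hρ U p) hβ
  unfold gfac
  calc |Real.exp (β * WilsonRP.plaqRe ρ U p) - 1 - β * WilsonRP.plaqRe ρ U p|
      ≤ (β * WilsonRP.plaqRe ρ U p) ^ 2 := Real.abs_exp_sub_one_sub_id_le (hx.trans hβN)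
    _ ≤ (β * N) ^ 2 := by
        rw [← sq_abs]
        exact pow_le_pow_left₀ (abs_nonneg _) hx 2

omit [NeZero L] [MeasurableSpace G] [BorelSpace G] [SecondCountableTopology G] [CompactSpace G] in
/-- The plaquette factor is continuous in the configuration. -/
theorem continuous_gfac (hρ : Continuous ρ) (p : Plaquette 3 L) :
    Continuous (gfac ρ β p : GaugeConfig 3 L G → ℝ) := by
  unfold gfac
  exact (Real.continuous_exp.comp (continuous_const.mul (continuous_plaqRe ρ hρ p))).sub
    continuous_const

omit [NeZero L] [MeasurableSpace G] [BorelSpace G] [SecondCountableTopology G] [CompactSpace G] in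
/-- The pair integrand is continuous. -/
theorem continuous_pairIntegrand (hρ : Continuous ρ) (S : Finset (Plaquette 3 L))
    (A B : ZMod L × ZMod L) : Continuous fun U : GaugeConfig 3 L G =>
      polRe ρ 2 U (vsite A 0) * polRe ρ 2 U (vsite B 0) * ∏ p ∈ S, gfac ρ β p U :=
  ((continuous_polRe ρ hρ 2 _).mul (continuous_polRe ρ hρ 2 _)).mul
    (continuous_finsetProd _ fun p _ => continuous_gfac ρ β hρ p)

omit [SecondCountableTopology G] in
/-- **Crude bound**: `|T_S(A,B)| ≤ N² (2βN)^{|S|}` for `0 ≤ β`, `βN ≤ 1`. -/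
theorem abs_pairTerm_le (hρ : Continuous ρ) (hβ : 0 ≤ β) (hβN : β * N ≤ 1)
    (S : Finset (Plaquette 3 L)) (A B : ZMod L × ZMod L) :
    |pairTerm ρ β S A B| ≤ N ^ 2 * (2 * β * N) ^ S.card := by
  unfold pairTerm
  have hbd : ∀ U : GaugeConfig 3 L G, ‖polRe ρ 2 U (vsite A 0) * polRe ρ 2 U (vsite B 0) *
      ∏ p ∈ S, gfac ρ β p U‖ ≤ N ^ 2 * (2 * β * N) ^ S.card := fun U => by
    rw [Real.norm_eq_abs, abs_mul, abs_mul, abs_prod]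
    have hP := abs_polRe_le ρ hρ (2 : Fin 3) U (vsite A 0)
    have hQ := abs_polRe_le ρ hρ (2 : Fin 3) U (vsite B 0)
    have hprod : ∏ p ∈ S, |gfac ρ β p U| ≤ (2 * β * N) ^ S.card := by
      rw [← prod_const]
      exact prod_le_prod (fun p _ => abs_nonneg _) fun p _ => abs_gfac_le ρ β hρ hβ hβN p U
    calc |polRe ρ 2 U (vsite A 0)| * |polRe ρ 2 U (vsite B 0)| * ∏ p ∈ S, |gfac ρ β p U|
        ≤ N * N * (2 * β * N) ^ S.card :=
          mul_le_mul (mul_le_mul hP hQ (abs_nonneg _) (Nat.cast_nonneg _)) hprod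
            (prod_nonneg fun p _ => abs_nonneg _) (by positivity)
      _ = N ^ 2 * (2 * β * N) ^ S.card := by ring
  have h := norm_integral_le_of_norm_le_const
    (μ := Measure.pi fun _ : Edge 3 L => haarProbability G) (ae_of_all _ hbd)
  rwa [probReal_univ, mul_one, Real.norm_eq_abs] at h

/-- **Vanishing, right column uncovered.** -/
theorem pairTerm_eq_zero_of_not_covers_right (hρ : Continuous ρ) {z₀ : G} {ω : ℂ}
    (hz₀ : ρ z₀ = ω • (1 : Matrix (Fin N) (Fin N) ℂ)) (hω : ω ≠ 1) {A B : ZMod L × ZMod L}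
    (hAB : A ≠ B) {S : Finset (Plaquette 3 L)} (hS : ¬ Covers S B) : pairTerm ρ β S A B = 0 := by
  obtain ⟨z, hz⟩ := exists_height_of_not_covers hS
  exact integral_polRe_mul_polRe_mul_prod_eq_zero ρ hρ hz₀ hω hAB S hz
    (fun _ x => Real.exp (β * x) - 1) fun _ =>
      (Real.continuous_exp.comp (continuous_const.mul continuous_id)).sub continuous_const

omit [SecondCountableTopology G] in
/-- The pair term is symmetric in the two columns. -/
theorem pairTerm_comm (S : Finset (Plaquette 3 L)) (A B : ZMod L × ZMod L) :
    pairTerm ρ β S A B = pairTerm ρ β S B A := by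
  unfold pairTerm
  exact integral_congr_ae (ae_of_all _ fun U => by ring)

/-- **Vanishing, left column uncovered.** -/
theorem pairTerm_eq_zero_of_not_covers_left (hρ : Continuous ρ) {z₀ : G} {ω : ℂ}
    (hz₀ : ρ z₀ = ω • (1 : Matrix (Fin N) (Fin N) ℂ)) (hω : ω ≠ 1) {A B : ZMod L × ZMod L}
    (hAB : A ≠ B) {S : Finset (Plaquette 3 L)} (hS : ¬ Covers S A) : pairTerm ρ β S A B = 0 := by
  rw [pairTerm_comm]
  exact pairTerm_eq_zero_of_not_covers_right ρ β hρ hz₀ hω hAB.symm hS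

/-- **Columns apart**: if `A`, `B` differ in both coordinates then EVERY pair term is bounded by
`N² γ^{L+1}`, `γ = 2βN ≤ 1` (a non-zero term needs `|S| ≥ 2L ≥ L + 1`). -/
theorem abs_pairTerm_le_of_apart (hρ : Continuous ρ) {z₀ : G} {ω : ℂ}
    (hz₀ : ρ z₀ = ω • (1 : Matrix (Fin N) (Fin N) ℂ)) (hω : ω ≠ 1) (hβ : 0 ≤ β)
    (hγ : 2 * β * N ≤ 1) (hL : 1 ≤ L) {A B : ZMod L × ZMod L} (h0 : A.1 ≠ B.1) (h1 : A.2 ≠ B.2)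
    (S : Finset (Plaquette 3 L)) : |pairTerm ρ β S A B| ≤ N ^ 2 * (2 * β * N) ^ (L + 1) := by
  have hAB : A ≠ B := fun h => h0 (by rw [h])
  have hβN : β * N ≤ 1 := by nlinarith [mul_nonneg hβ (Nat.cast_nonneg N : (0 : ℝ) ≤ N)]
  by_cases hA : Covers S A
  · by_cases hB : Covers S B
    · have hcard := two_mul_le_card_of_covers h0 h1 hA hB
      refine (abs_pairTerm_le ρ β hρ hβ hβN S A B).trans ?_
      exact mul_le_mul_of_nonneg_left (pow_le_pow_of_le_one (by positivity) hγ (by omega))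
        (by positivity)
    · rw [pairTerm_eq_zero_of_not_covers_right ρ β hρ hz₀ hω hAB hB, abs_zero]
      positivity
  · rw [pairTerm_eq_zero_of_not_covers_left ρ β hρ hz₀ hω hAB hA, abs_zero]
    positivity

/-- **Adjacent columns, not the ladder**: for `A = B + e_a` and `S ≠ ladder B (a,2)`, the pair term
is bounded by `N² γ^{L+1}` (`L ≥ 3`; a non-zero term needs a cover of both columns by `≠` the
ladder, hence `|S| ≥ L + 1`, `eq_ladder_of_covers`). -/
theorem abs_pairTerm_le_of_adjacent (hρ : Continuous ρ) {z₀ : G} {ω : ℂ}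
    (hz₀ : ρ z₀ = ω • (1 : Matrix (Fin N) (Fin N) ℂ)) (hω : ω ≠ 1) (hβ : 0 ≤ β)
    (hγ : 2 * β * N ≤ 1) (hL : 3 ≤ L) (pl : {q : Fin 3 × Fin 3 // q.1 < q.2}) (hpl : pl.1.2 = 2)
    (B : ZMod L × ZMod L) {S : Finset (Plaquette 3 L)} (hS : S ≠ ladder B pl) :
    |pairTerm ρ β S (bump pl.1.1 B) B| ≤ N ^ 2 * (2 * β * N) ^ (L + 1) := by
  have hAB : bump pl.1.1 B ≠ B := bump_ne_self (by omega) (fst_ne_two pl hpl) B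
  have hβN : β * N ≤ 1 := by nlinarith [mul_nonneg hβ (Nat.cast_nonneg N : (0 : ℝ) ≤ N)]
  by_cases hA : Covers S (bump pl.1.1 B)
  · by_cases hB : Covers S B
    · have hcard : L + 1 ≤ S.card := by
        by_contra hlt
        exact hS (eq_ladder_of_covers hL pl hpl B hA hB (by omega))
      refine (abs_pairTerm_le ρ β hρ hβ hβN S _ B).trans ?_
      exact mul_le_mul_of_nonneg_left (pow_le_pow_of_le_one (by positivity) hγ hcard)
        (by positivity)
    · rw [pairTerm_eq_zero_of_not_covers_right ρ β hρ hz₀ hω hAB hB, abs_zero]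
      positivity
  · rw [pairTerm_eq_zero_of_not_covers_left ρ β hρ hz₀ hω hAB hA, abs_zero]
    positivity

/-- **The ladder term is `β^L I(A,B)` to leading order**:
`|T_{ladder}(A,B) - β^L I(A,B)| ≤ N² 2^L (βN)^{L+1}` for `0 ≤ β`, `βN ≤ 1`. -/
theorem abs_pairTerm_ladder_sub_le (hρ : Continuous ρ) (hβ : 0 ≤ β) (hβN : β * N ≤ 1)
    (pl : {q : Fin 3 × Fin 3 // q.1 < q.2}) (B : ZMod L × ZMod L) :
    |pairTerm ρ β (ladder B pl) (bump pl.1.1 B) B - β ^ L * ladderIntegral ρ pl B| ≤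
      N ^ 2 * (2 ^ L * (β * N) ^ (L + 1)) := by
  have hinj : Function.Injective fun z : ZMod L => ((vsite B z, pl) : Plaquette 3 L) :=
    fun z w h => (vsite_eq_vsite_iff.1 (congrArg Prod.fst h)).2
  -- both terms as integrals over the same product of rung factors
  have hlad : ∀ U : GaugeConfig 3 L G, ∏ p ∈ ladder B pl, gfac ρ β p U =
      ∏ z : ZMod L, gfac ρ β (vsite B z, pl) U := fun U => by
    unfold ladder
    rw [prod_image fun z _ w _ h => hinj h]
  have hpow : ∀ U : GaugeConfig 3 L G, β ^ L * ∏ z : ZMod L, WilsonRP.plaqRe ρ U (vsite B z, pl) =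
      ∏ z : ZMod L, β * WilsonRP.plaqRe ρ U (vsite B z, pl) := fun U => by
    rw [prod_mul_distrib, prod_const, card_univ, ZMod.card]
  have hcont : Continuous fun U : GaugeConfig 3 L G =>
      polRe ρ 2 U (vsite (bump pl.1.1 B) 0) * polRe ρ 2 U (vsite B 0) *
        ∏ z : ZMod L, WilsonRP.plaqRe ρ U (vsite B z, pl) :=
    ((continuous_polRe ρ hρ 2 _).mul (continuous_polRe ρ hρ 2 _)).mul
      (continuous_finsetProd _ fun z _ => continuous_plaqRe ρ hρ _)
  have hI2 : Integrable (fun U : GaugeConfig 3 L G => β ^ L *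
      (polRe ρ 2 U (vsite (bump pl.1.1 B) 0) * polRe ρ 2 U (vsite B 0) *
        ∏ z : ZMod L, WilsonRP.plaqRe ρ U (vsite B z, pl)))
      (Measure.pi fun _ : Edge 3 L => haarProbability G) :=
    (integrable_of_continuous_config hcont).const_mul _
  unfold pairTerm ladderIntegral
  rw [← integral_const_mul, ← integral_sub (integrable_of_continuous_config
      (continuous_pairIntegrand ρ β hρ _ _ _)) hI2]
  have hbd : ∀ U : GaugeConfig 3 L G,
      ‖polRe ρ 2 U (vsite (bump pl.1.1 B) 0) * polRe ρ 2 U (vsite B 0) *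
          ∏ p ∈ ladder B pl, gfac ρ β p U -
        β ^ L * (polRe ρ 2 U (vsite (bump pl.1.1 B) 0) * polRe ρ 2 U (vsite B 0) *
          ∏ z : ZMod L, WilsonRP.plaqRe ρ U (vsite B z, pl))‖ ≤
      N ^ 2 * (2 ^ L * (β * N) ^ (L + 1)) := fun U => by
    have hfold : β ^ L * (polRe ρ 2 U (vsite (bump pl.1.1 B) 0) * polRe ρ 2 U (vsite B 0) *
        ∏ z : ZMod L, WilsonRP.plaqRe ρ U (vsite B z, pl)) =
        polRe ρ 2 U (vsite (bump pl.1.1 B) 0) * polRe ρ 2 U (vsite B 0) *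
          ∏ z : ZMod L, β * WilsonRP.plaqRe ρ U (vsite B z, pl) := by
      rw [← hpow]; ring
    rw [hlad, hfold, ← mul_sub, Real.norm_eq_abs, abs_mul, abs_mul]
    have hP := abs_polRe_le ρ hρ (2 : Fin 3) U (vsite (bump pl.1.1 B) 0)
    have hQ := abs_polRe_le ρ hρ (2 : Fin 3) U (vsite B 0)
    have hdiff := abs_prod_add_sub_prod_le (univ : Finset (ZMod L))
      (fun z => β * WilsonRP.plaqRe ρ U (vsite B z, pl))
      (fun z => gfac ρ β (vsite B z, pl) U - β * WilsonRP.plaqRe ρ U (vsite B z, pl))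
      (t := β * N) (by positivity) hβN
      (fun z _ => by
        rw [abs_mul, abs_of_nonneg hβ]
        exact mul_le_mul_of_nonneg_left (WilsonRP.abs_plaqRe_le ρ hρ U _) hβ)
      (fun z _ => abs_gfac_sub_le ρ β hρ hβ hβN _ U)
    simp only [add_sub_cancel, card_univ, ZMod.card] at hdiff
    calc |polRe ρ 2 U (vsite (bump pl.1.1 B) 0)| * |polRe ρ 2 U (vsite B 0)| *
          |∏ z : ZMod L, gfac ρ β (vsite B z, pl) U -
            ∏ z : ZMod L, β * WilsonRP.plaqRe ρ U (vsite B z, pl)|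
        ≤ N * N * (2 ^ L * (β * N) ^ (L + 1)) :=
          mul_le_mul (mul_le_mul hP hQ (abs_nonneg _) (Nat.cast_nonneg _)) hdiff
            (abs_nonneg _) (by positivity)
      _ = N ^ 2 * (2 ^ L * (β * N) ^ (L + 1)) := by ring
  have h := norm_integral_le_of_norm_le_const
    (μ := Measure.pi fun _ : Edge 3 L => haarProbability G) (ae_of_all _ hbd)
  rwa [probReal_univ, mul_one, Real.norm_eq_abs] at h

end Pair

/-! ## Polyakov loops: swap covariance and support -/

section Loops

variable {L : ℕ} [NeZero L] {N : ℕ} {G : Type*} [Group G] [TopologicalSpace G]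
  [IsTopologicalGroup G] [CompactSpace G] [MeasurableSpace G] [BorelSpace G]
  [SecondCountableTopology G] (ρ : G →* Matrix (Fin N) (Fin N) ℂ)

omit [NeZero L] in
/-- The diagonal swap of the coordinates `0, 1` maps the column `A` to the column `A.swap`. -/
theorem siteDiagSwap_vsite (A : ZMod L × ZMod L) (z : ZMod L) :
    siteDiagSwap (0 : Fin 3) 1 (vsite A z) = vsite A.swap z := by
  funext i
  fin_cases i <;> simp [siteDiagSwap, vsite, Equiv.swap_apply_left, Equiv.swap_apply_right,
    Equiv.swap_apply_of_ne_of_ne]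

omit [NeZero L] [TopologicalSpace G] [IsTopologicalGroup G] [CompactSpace G] [MeasurableSpace G]
  [BorelSpace G] [SecondCountableTopology G] in
/-- `P_A ∘ Θ = P_{A.swap}`. -/
theorem polRe_configDiagSwap_vsite (U : GaugeConfig 3 L G) (A : ZMod L × ZMod L) :
    polRe ρ 2 (configDiagSwap (0 : Fin 3) 1 U) (vsite A 0) = polRe ρ 2 U (vsite A.swap 0) := by
  rw [polRe_configDiagSwap ρ (by decide) (by decide), siteDiagSwap_vsite]

omit [NeZero L] [TopologicalSpace G] [IsTopologicalGroup G] [CompactSpace G] [MeasurableSpace G]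
  [BorelSpace G] [SecondCountableTopology G] in
/-- `P_A` reads only the vertical links over the column `A`. -/
theorem polRe_vsite_congr (A : ZMod L × ZMod L) {U V : GaugeConfig 3 L G}
    (h : ∀ e : Edge 3 L, ccnt A e ≠ 0 → U e = V e) :
    polRe ρ 2 U (vsite A 0) = polRe ρ 2 V (vsite A 0) := by
  unfold polRe
  rw [WilsonLoopRP.lineHolonomy_congr 2 L (vsite A 0) fun s _ => ?_]
  rw [vsite_add_single_two]
  refine h _ ?_
  unfold ccnt
  rw [if_pos ⟨rfl, rfl, rfl⟩]
  exact one_ne_zero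

end Loops

end DiagRPSUN

end

end Summit.QuantumFields.GaugeBoot
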